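import Literature.Probability.Percolation.ConnectivityThetaSqProofs
import HarnessLib

/-!
# Second-moment void bound for the infinite cluster on `ℤ^d`

Route `PercRayRenewal`, item `JumpLineAvoidanceDecay` (stmt-CriticalPhenomena-4626), helper file:
the engine of the two-point ("infrared") form of the void-decay statement. For nearest-neighbour
bond percolation on `ℤ^d` (every `d`, every `p ∈ [0, 1]`) and every finite vertex set `T`,
writing `A_x = {|C(x)| = ∞}`, `θ = θ(p)`, `E = {ω | ∀ x ∈ T, ω ∉ A_x}` (the set `T` avoids the
infinite cluster) and `τ_p(x, y) = P_p(x ↔ y)`,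

`P_p(E) · (θ |T|)² ≤ Σ_{x, y ∈ T} (τ_p(x, y) - θ²)`.

Proof (elementary second-moment computation). Let `N = Σ_{x ∈ T} 1_{A_x}` and `c = θ |T|`.
* On `E` one has `N = 0`, so `P(E) c² = ∫_E (N - c)² dP ≤ ∫ (N - c)² dP` (the integrand is a
  square).
* Expanding the square, `∫ (N - c)² = Σ_{x,y} P(A_x ∩ A_y) - 2c Σ_x P(A_x) + c²`
  (`1_{A_x} 1_{A_y} = 1_{A_x ∩ A_y}`); this is the abstract lemma
  `VoidSecondMoment.real_setOf_forall_notMem_mul_sq_le` below, valid for any probability measure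
  and any finite family of events.
* By translation invariance `P(A_x) = θ` (`theta_zdGraph_eq_theta_zero`), so the right-hand side
  is `Σ_{x,y} (P(A_x ∩ A_y) - θ²)`, and `P(A_x ∩ A_y) ≤ τ_p(x, y)` by a.s. uniqueness of the
  infinite open cluster (`real_percolatesAt_inter_le_real_openConn` with
  `Grimmett1999_numInfiniteClusters_le_one_holds`).

## References

* G. Grimmett, *Percolation*, 2nd ed., Springer 1999, §8.5 p. 213 (`τ_p(x, y) ≥ P_p(|C(x)| =
  ∞, |C(y)| = ∞)` by uniqueness, Thm. (8.1) p. 198), §1.4 p. 13 (translation invariance)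
  [GrimmettPercolation1999].
-/

noncomputable section

namespace Summit.CriticalPhenomena.PercolationContinuityZ3.Theorems

open MeasureTheory Literature.Probability.Percolation Literature.Probability.LatticeModels

namespace VoidSecondMoment

variable {Ω ι : Type*} [MeasurableSpace Ω]

/-- **Abstract second-moment void bound.** For a probability measure `μ`, a finite family of
events `(A x)_{x ∈ T}` and a real `c`: with `N = Σ_{x ∈ T} 1_{A x}`,
`μ(∀ x ∈ T, ω ∉ A x) · c² = ∫_{N = 0 on T} (N - c)² ≤ ∫ (N - c)²
= Σ_{x,y ∈ T} μ(A x ∩ A y) - 2c Σ_{x ∈ T} μ(A x) + c²`. [folklore] -/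
theorem real_setOf_forall_notMem_mul_sq_le (μ : Measure Ω) [IsProbabilityMeasure μ]
    (T : Finset ι) (A : ι → Set Ω) (hA : ∀ x, MeasurableSet (A x)) (c : ℝ) :
    μ.real {ω | ∀ x ∈ T, ω ∉ A x} * c ^ 2 ≤
      ∑ x ∈ T, ∑ y ∈ T, μ.real (A x ∩ A y) - 2 * c * ∑ x ∈ T, μ.real (A x) + c ^ 2 := by
  -- the void event is measurable
  have hE : MeasurableSet {ω | ∀ x ∈ T, ω ∉ A x} := by
    have h : {ω | ∀ x ∈ T, ω ∉ A x} = ⋂ x ∈ T, (A x)ᶜ := by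
      ext ω
      simp only [Set.mem_setOf_eq, Set.mem_iInter, Set.mem_compl_iff]
    rw [h]
    exact Finset.measurableSet_biInter T fun x _ => (hA x).compl
  -- indicators and their products are integrable
  have ha : ∀ x, Integrable ((A x).indicator (1 : Ω → ℝ)) μ :=
    fun x => (integrable_const (1 : ℝ)).indicator (hA x)
  have hprod : ∀ x y, (fun ω => (A x).indicator (1 : Ω → ℝ) ω * (A y).indicator 1 ω) =
      (A x ∩ A y).indicator (1 : Ω → ℝ) := by
    intro x y
    rw [Set.inter_indicator_one]
    rfl
  have haa : ∀ x y,
      Integrable (fun ω => (A x).indicator (1 : Ω → ℝ) ω * (A y).indicator 1 ω) μ := by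
    intro x y
    rw [hprod x y]
    exact (integrable_const (1 : ℝ)).indicator ((hA x).inter (hA y))
  -- the expanded square
  have hexp : ∀ ω, (∑ x ∈ T, (A x).indicator (1 : Ω → ℝ) ω - c) ^ 2 =
      ∑ x ∈ T, ∑ y ∈ T, (A x).indicator (1 : Ω → ℝ) ω * (A y).indicator 1 ω -
        2 * c * ∑ x ∈ T, (A x).indicator (1 : Ω → ℝ) ω + c ^ 2 := by
    intro ω
    rw [sub_sq, sq (∑ x ∈ T, (A x).indicator (1 : Ω → ℝ) ω), Finset.sum_mul_sum]
    ring
  have hint : Integrable (fun ω => (∑ x ∈ T, (A x).indicator (1 : Ω → ℝ) ω - c) ^ 2) μ := by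
    simp_rw [hexp]
    exact (((integrable_finsetSum T fun x _ => integrable_finsetSum T fun y _ => haa x y).sub
      ((integrable_finsetSum T fun x _ => ha x).const_mul (2 * c))).add (integrable_const _))
  have hnonneg : 0 ≤ᵐ[μ] fun ω => (∑ x ∈ T, (A x).indicator (1 : Ω → ℝ) ω - c) ^ 2 :=
    Filter.Eventually.of_forall fun ω => sq_nonneg _
  -- on the void event the integrand is the constant `c ^ 2`
  have honE : Set.EqOn (fun _ => c ^ 2)
      (fun ω => (∑ x ∈ T, (A x).indicator (1 : Ω → ℝ) ω - c) ^ 2) {ω | ∀ x ∈ T, ω ∉ A x} := by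
    intro ω hω
    have h0 : ∑ x ∈ T, (A x).indicator (1 : Ω → ℝ) ω = 0 :=
      Finset.sum_eq_zero fun x hx => Set.indicator_of_notMem (hω x hx) _
    simp only [h0, zero_sub, neg_sq]
  calc μ.real {ω | ∀ x ∈ T, ω ∉ A x} * c ^ 2
      = ∫ _ in {ω | ∀ x ∈ T, ω ∉ A x}, c ^ 2 ∂μ := by rw [setIntegral_const, smul_eq_mul]
    _ = ∫ ω in {ω | ∀ x ∈ T, ω ∉ A x},
          (∑ x ∈ T, (A x).indicator (1 : Ω → ℝ) ω - c) ^ 2 ∂μ := setIntegral_congr_fun hE honE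
    _ ≤ ∫ ω, (∑ x ∈ T, (A x).indicator (1 : Ω → ℝ) ω - c) ^ 2 ∂μ :=
        setIntegral_le_integral hint hnonneg
    _ = ∑ x ∈ T, ∑ y ∈ T, μ.real (A x ∩ A y) - 2 * c * ∑ x ∈ T, μ.real (A x) + c ^ 2 := by
        simp_rw [hexp]
        rw [integral_add _ (integrable_const _), integral_sub, integral_finsetSum T,
          integral_const_mul, integral_finsetSum T fun x _ => ha x, integral_const, probReal_univ,
          one_smul]
        · congr 1
          · congr 1
            · refine Finset.sum_congr rfl fun x _ => ?_
              rw [integral_finsetSum T fun y _ => haa x y]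
              refine Finset.sum_congr rfl fun y _ => ?_
              rw [hprod x y, integral_indicator_one ((hA x).inter (hA y))]
            · congr 1
              exact Finset.sum_congr rfl fun x _ => integral_indicator_one (hA x)
        · exact fun x _ => integrable_finsetSum T fun y _ => haa x y
        · exact integrable_finsetSum T fun x _ => integrable_finsetSum T fun y _ => haa x y
        · exact (integrable_finsetSum T fun x _ => ha x).const_mul (2 * c)
        · exact (integrable_finsetSum T fun x _ => integrable_finsetSum T fun y _ => haa x y).sub
            ((integrable_finsetSum T fun x _ => ha x).const_mul (2 * c))

end VoidSecondMoment

/-- **Second-moment void bound under uniqueness** (engine of the two-point form of the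
void-decay statement): for bond percolation on `ℤ^d`, every `d`, every `p ∈ [0, 1]` and every
finite `T ⊆ ℤ^d`, `P_p(T ∩ (infinite cluster) = ∅) · (θ(p) |T|)² ≤ Σ_{x,y ∈ T} (τ_p(x,y) - θ(p)²)`:
the abstract second-moment bound `VoidSecondMoment.real_setOf_forall_notMem_mul_sq_le` for the
events `{|C(x)| = ∞}`, translation invariance `P_p(|C(x)| = ∞) = θ(p)`
(`theta_zdGraph_eq_theta_zero`) and `P_p(|C(x)| = ∞, |C(y)| = ∞) ≤ τ_p(x, y)` from a.s.
uniqueness of the infinite cluster (`real_percolatesAt_inter_le_real_openConn`,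
`Grimmett1999_numInfiniteClusters_le_one_holds`; Grimmett 1999 §8.5 p. 213). [folklore] -/
theorem real_void_mul_sq_le_sum_openConn_sub (d : ℕ) (p : unitInterval) (T : Finset (Site d)) :
    (bondPercolation (zdGraph d) p).real {ω | ∀ x ∈ T, ω ∉ percolatesAt x} *
        (theta (zdGraph d) (0 : Site d) p * T.card) ^ 2 ≤
      ∑ x ∈ T, ∑ y ∈ T,
        ((bondPercolation (zdGraph d) p).real (openConn x y) -
          theta (zdGraph d) (0 : Site d) p ^ 2) := by
  have hA : ∀ x : Site d, MeasurableSet (percolatesAt x : Set (BondConfig (Site d))) :=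
    fun x => measurableSet_percolatesAt_holds x
  have hθ : ∀ x : Site d, (bondPercolation (zdGraph d) p).real (percolatesAt x) =
      theta (zdGraph d) (0 : Site d) p :=
    fun x => theta_zdGraph_eq_theta_zero p x
  have hsum : ∑ x ∈ T, (bondPercolation (zdGraph d) p).real (percolatesAt x) =
      theta (zdGraph d) (0 : Site d) p * T.card := by
    rw [Finset.sum_congr rfl fun x _ => hθ x, Finset.sum_const, nsmul_eq_mul, mul_comm]
  have key := VoidSecondMoment.real_setOf_forall_notMem_mul_sq_le (bondPercolation (zdGraph d) p)
    T (fun x => percolatesAt x) hA (theta (zdGraph d) (0 : Site d) p * T.card)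
  rw [hsum] at key
  calc (bondPercolation (zdGraph d) p).real {ω | ∀ x ∈ T, ω ∉ percolatesAt x} *
        (theta (zdGraph d) (0 : Site d) p * T.card) ^ 2
      ≤ ∑ x ∈ T, ∑ y ∈ T, (bondPercolation (zdGraph d) p).real (percolatesAt x ∩ percolatesAt y) -
          2 * (theta (zdGraph d) (0 : Site d) p * T.card) *
            (theta (zdGraph d) (0 : Site d) p * T.card) +
          (theta (zdGraph d) (0 : Site d) p * T.card) ^ 2 := key
    _ = ∑ x ∈ T, ∑ y ∈ T, ((bondPercolation (zdGraph d) p).real (percolatesAt x ∩ percolatesAt y) -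
          theta (zdGraph d) (0 : Site d) p ^ 2) := by
        simp only [Finset.sum_sub_distrib, Finset.sum_const]
        ring
    _ ≤ ∑ x ∈ T, ∑ y ∈ T, ((bondPercolation (zdGraph d) p).real (openConn x y) -
          theta (zdGraph d) (0 : Site d) p ^ 2) :=
        Finset.sum_le_sum fun x _ => Finset.sum_le_sum fun y _ => sub_le_sub_right
          (real_percolatesAt_inter_le_real_openConn (zdGraph d) p
            (Grimmett1999_numInfiniteClusters_le_one_holds d p) x y) _

end Summit.CriticalPhenomena.PercolationContinuityZ3.Theorems

end
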